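/-
Copyright: public-domain mathematics; typed transcription for the H21 Literature library (cell lit-balaban,
Phase-2 proof seat p38 gen 7 = literature-prover-lit-balaban-p38-g7-0).

statement-level skeleton of published theorems with citation tags; proofs where landed; nothing here is a claim about the Yang–Mills mass gap

# Bałaban, *Propagators and renormalization transformations for lattice gauge theories. I*,
# Commun. Math. Phys. **95** (1984) 17–40 — THE SIX ENTRIES `ζ D₁ G D₂ J` OF (1.114) ON THE `L²(T_η)` CARRIER OF THE
# RANDOM WALK, FOR THE OPERATOR `G = Δ_a⁻¹` OF RECORD: sources, cut-offs, `∇`, `∇*`, `∇∇`, `∇*∇*` between tensor grades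

[cite: Balaban1984PropagatorsI]  T. Bałaban, Commun. Math. Phys. 95 (1984) 17–40.  p. 33 Prop. 1.1 «‖GJ‖, ‖∇GJ‖, ‖G∇*J‖,
‖∇G∇*J‖, ‖∇∇GJ‖, ‖G∇*∇*J‖ ≤ γ₀⁻¹‖J‖, (1.89)»; p. 36 Prop. 1.2 «‖ζGJ‖, ‖ζ∇GJ‖, ‖ζG∇*J‖, ‖ζ∇G∇*J‖, ‖ζ∇∇GJ‖, ‖ζG∇*∇*J‖
≤ O(1)e^{−δ₀|y−y′|}·|ζ|·‖J‖  (1.114)» for «a function ζ ∈ C₀^∞(Δ̃(y))» and «supp J ⊂ Δ̃(y′)»; p. 21 (1.21) the scalar product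
of `L²(T_η)` with weight `η^d`; p. 39 «in the estimates of G∇*J we have to take a representation of G adjoint to (1.123)».

WHAT THIS MODULE ADDS (SKELETON rows B5.Eq1.114 / B5.Eq1.118–1.131, owner r02; GAPS G-B5-03 = the printed random-walk route
for G; target record `B5Local114.Realisation` for r02's setting of record `B5SettingP12Real.latticeSettingP12R n M a k`, whose
entries are written `cut ζ ∘ D1 m ∘ G ∘ D2 m ∘ vec J`, `D1 = (1, ∇, 1, ∇, ∇∇, 1)`, `D2 = (1, 1, ∇*, ∇*, 1, ∇*∇*)`, `Dadj m = (D2 m)†`).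
On the graded carrier `Vsp n M` of `B5WalkCarrierTorus` (grades `g0` = vector fields, `g1 ν` = 2-tensor fields, `g2 (ν,ν′)` =
3-tensor fields) we define, from pv15's real difference matrices `fdiffR ν = re ∇_ν` of the torus of record:
* §1 the grade bookkeeping (`sum_Gr`, `normSq_Gr`);
* §2 ONE inter-grade kernel `divK` — `∇*` lowering the grade (`(∇*g)₀ = Σ_ν ∇_νᵀ g_ν = divTR`, `(∇*g)_μ = Σ_{ν′} ∇_{ν′}ᵀ g_{μν′}`)
  — and its transpose `gradK` — `∇` raising the grade (`(∇f)_ν = ∇_ν f₀ = gradR`, `(∇f)_{μν′} = ∇_{ν′} f_μ`); the operators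
  `divOp`, `gradOp` with their SLICE FORMULAS, the adjoint pair `⟨∇u, v⟩ = ⟨u, ∇*v⟩` (definitional: one kernel, transposed),
  `∇*∇* = divT2R` and `∇∇ = grad2R` (up to the order of the two indices) on the relevant grades, and the norm identities
  `‖∇f‖² = ‖∇f₀‖² + Σ_μ‖∇f_μ‖²`, `‖∇∇f‖² = ‖∇∇f₀‖²` with the slicewise comparison lemmas the certificates use;
* §3 the cut-offs `cut ζ` (multiplication by `ζ(x)` on every grade: symmetric, `‖ζv‖ ≤ |ζ|‖v‖` — fields `symmCut`, `hcut`, `hcut0`);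
* §4 the sources `vec J = η^{d/2}·(J placed in its grade)` with `‖vec J‖ = ‖J‖_{L²(T_η)}` EXACTLY (field `hvec`);
* §5 the three operator tables `D1v`, `D2v`, `Dadjv` and THE FIELD `hentry`: for every `m`, `J`, `ζ` the localized norm
  `l2loc m J ζ` of the setting of record is `≤ ‖cut ζ (D1v m (G (D2v m (vec J))))‖` (equality in the six printed cases, `0 ≤ ·`
  in the twelve off-table ones), through pv15's complexification dictionary `cplx_GR_mulVec`, `cplx_gradR`, `cplx_grad2R`,
  `cplx_divTR`, `cplx_divT2R`; and the adjoint pairs `⟨Dadjv m u, v⟩ = ⟨u, D2v m v⟩` (p. 39).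

HONEST SCOPE.  Index bookkeeping over finite-dimensional `ℓ²`; no estimate of the paper is proved here.  value = the located
leaves `vec/cut/D1/D2/Dadj/hvec/hcut/hcut0/hentry/symmCut` of `B5Local114.Realisation` for the torus of record — NOT summit progress.
-/
import Mathlib
import Literature.MathematicalPhysics.QuantumFieldTheory.Balaban1983to89.B5WalkCarrierTorus

open scoped BigOperators Real Matrix
open Finset Matrix

namespace Literature.MathematicalPhysics.QuantumFieldTheory.Balaban1983to89.B5WalkEntriesTorus

open Literature.MathematicalPhysics.QuantumFieldTheory.Balaban1983to89
open Literature.MathematicalPhysics.QuantumFieldTheory.Balaban1983to89.B5Prop11Plancherel (Tor fine)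
open Literature.MathematicalPhysics.QuantumFieldTheory.Balaban1983to89.B5DeltaA169 (DeltaA)
open Literature.MathematicalPhysics.QuantumFieldTheory.Balaban1983to89.B5Prop11Lattice (l2 l2T grad grad2 divT divT2)
open Literature.MathematicalPhysics.QuantumFieldTheory.Balaban1983to89.B5Prop11SettingModel (Loc189 locNorm locNorm_nonneg l2op189)
open Literature.MathematicalPhysics.QuantumFieldTheory.Balaban1983to89.B5Prop12FieldsLattice (smulV smulT cutSupL cutSupL_nonneg l2locL)
open Literature.MathematicalPhysics.QuantumFieldTheory.Balaban1983to89.B5Commutator128 (kerOp kerOp_apply)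
open Literature.MathematicalPhysics.QuantumFieldTheory.Balaban1983to89.B5TorusPartition (mulOp mulOp_apply inner_mulOp_left norm_mulOp_le)
open Literature.MathematicalPhysics.QuantumFieldTheory.Balaban1983to89.B5RealFields (GR fdiffR l2R l2TR gradR grad2R divTR divT2R cplx
  l2R_eq l2TR_eq l2R_nonneg cplx_GR_mulVec cplx_gradR cplx_grad2R cplx_divTR cplx_divT2R)
open Literature.MathematicalPhysics.QuantumFieldTheory.Balaban1983to89.B5SettingP12Weighted (sqEta sqEta_nonneg)
open Literature.MathematicalPhysics.QuantumFieldTheory.Balaban1983to89.B5SettingP12Real (LocR latticeSettingP12R)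
open Literature.MathematicalPhysics.QuantumFieldTheory.Balaban1983to89.B5WalkTorusGeom (TorR ucPt Cen)
open Literature.MathematicalPhysics.QuantumFieldTheory.Balaban1983to89.B5WalkPartitionTorus (hz)
open Literature.MathematicalPhysics.QuantumFieldTheory.Balaban1983to89.B5WalkCarrierTorus (Gr Bnd Idx Vsp sl sl_apply normSq_eq
  normSq_eq_sum_l2R_sq l2R_sq l2TR_sq liftK Gop sl_Gop Hop inner_kerOp_left Dg normSq_Dg)

noncomputable section

variable {d : ℕ}

/-! ## §1 Grades -/

section Grades

/-- grade `0`: vector fields. [cite: Balaban1984PropagatorsI, Prop. 1.1 (1.89) p.33 (J, GJ)] -/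
def g0 : Gr d := Sum.inl ()

/-- grade `1`, component `ν`: the `ν`-th member of a 2-tensor field `(J_ν)_ν`. [cite: Balaban1984PropagatorsI, Prop. 1.1 (1.89) p.33 (∇GJ, G∇*J)] -/
def g1 (ν : Fin d) : Gr d := Sum.inr (Sum.inl ν)

/-- grade `2`, component `(ν, ν′)`: a member of a 3-tensor field. [cite: Balaban1984PropagatorsI, Prop. 1.1 (1.89) p.33 (∇∇GJ, G∇*∇*J)] -/
def g2 (p : Fin d × Fin d) : Gr d := Sum.inr (Sum.inr p)

/-- a sum over the grades splits into the three kinds. [cite: Balaban1984PropagatorsI, Prop. 1.1 (1.89) p.33] -/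
theorem sum_Gr {β : Type*} [AddCommMonoid β] (φ : Gr d → β) :
    ∑ r, φ r = φ g0 + ∑ ν, φ (g1 ν) + ∑ p, φ (g2 p) := by
  rw [Fintype.sum_sum_type, Fintype.sum_sum_type, Fintype.sum_unique, add_assoc]
  rfl

variable {n : ℕ} [NeZero n] {M : Fin d → ℕ} [hM : ∀ μ, NeZero (M μ)]

/-- `‖f‖² = ‖f₀‖² + Σ_ν ‖f_ν‖² + Σ_{νν′} ‖f_{νν′}‖²`. [cite: Balaban1984PropagatorsI, Prop. 1.1 p.33 (L²(T_η))] -/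
theorem normSq_Gr (f : Vsp n M) :
    ‖f‖ ^ 2 = l2R (sl f g0) ^ 2 + ∑ ν, l2R (sl f (g1 ν)) ^ 2 + ∑ p, l2R (sl f (g2 p)) ^ 2 := by
  rw [normSq_eq_sum_l2R_sq, sum_Gr]

omit [NeZero n] hM in
/-- `l2TR F² = Σ_s l2R (F s)²`. [cite: Balaban1984PropagatorsI, Prop. 1.1 p.33] -/
theorem l2TR_sq_sum {S m : Type*} [Fintype S] [Fintype m] (F : S → m → ℝ) : l2TR F ^ 2 = ∑ s, l2R (F s) ^ 2 := by
  rw [l2TR_sq]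
  exact Finset.sum_congr rfl fun s _ => (l2R_sq _).symm

omit [NeZero n] hM in
/-- `0 ≤ l2TR F`. [cite: Balaban1984PropagatorsI, Prop. 1.1 p.33] -/
theorem l2TR_nonneg {S m : Type*} [Fintype S] [Fintype m] (F : S → m → ℝ) : 0 ≤ l2TR F := Real.sqrt_nonneg _

omit [NeZero n] hM in
/-- `l2R 0 = 0`. [cite: Balaban1984PropagatorsI, Prop. 1.1 p.33] -/
theorem l2R_zero {m : Type*} [Fintype m] : l2R (0 : m → ℝ) = 0 := by simp [l2R]

/-- one slice is below the whole: `‖f_r‖ ≤ ‖f‖`. [cite: Balaban1984PropagatorsI, Prop. 1.1 p.33] -/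
theorem l2R_sl_le_norm (f : Vsp n M) (r : Gr d) : l2R (sl f r) ≤ ‖f‖ := by
  have h2 : l2R (sl f r) ^ 2 ≤ ‖f‖ ^ 2 := by
    rw [normSq_eq_sum_l2R_sq]
    exact Finset.single_le_sum (f := fun r => l2R (sl f r) ^ 2) (fun _ _ => sq_nonneg _) (Finset.mem_univ r)
  exact (pow_le_pow_iff_left₀ (l2R_nonneg _) (norm_nonneg _) two_ne_zero).mp h2

/-- the grade-1 slices are below the whole. [cite: Balaban1984PropagatorsI, Prop. 1.1 p.33] -/
theorem l2TR_sl_g1_le_norm (f : Vsp n M) : l2TR (fun ν => sl f (g1 ν)) ≤ ‖f‖ := by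
  have h2 : l2TR (fun ν => sl f (g1 ν)) ^ 2 ≤ ‖f‖ ^ 2 := by
    rw [l2TR_sq_sum, normSq_Gr]
    have h0 := sq_nonneg (l2R (sl f g0))
    have h3 : 0 ≤ ∑ p, l2R (sl f (g2 p)) ^ 2 := Finset.sum_nonneg fun _ _ => sq_nonneg _
    linarith
  exact (pow_le_pow_iff_left₀ (l2TR_nonneg _) (norm_nonneg _) two_ne_zero).mp h2

/-- the grade-2 slices (listed with the two indices swapped) are below the whole. [cite: Balaban1984PropagatorsI, Prop. 1.1 p.33] -/
theorem l2TR_sl_g2_swap_le_norm (f : Vsp n M) : l2TR (fun p : Fin d × Fin d => sl f (g2 (p.2, p.1))) ≤ ‖f‖ := by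
  have h2 : l2TR (fun p : Fin d × Fin d => sl f (g2 (p.2, p.1))) ^ 2 ≤ ‖f‖ ^ 2 := by
    rw [l2TR_sq_sum, normSq_Gr]
    have e : ∑ p : Fin d × Fin d, l2R (sl f (g2 (p.2, p.1))) ^ 2 = ∑ p, l2R (sl f (g2 p)) ^ 2 :=
      Fintype.sum_equiv (Equiv.prodComm (Fin d) (Fin d)) _ _ fun _ => rfl
    rw [e]
    have h0 := sq_nonneg (l2R (sl f g0))
    have h1 : 0 ≤ ∑ ν, l2R (sl f (g1 ν)) ^ 2 := Finset.sum_nonneg fun _ _ => sq_nonneg _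
    linarith
  exact (pow_le_pow_iff_left₀ (l2TR_nonneg _) (norm_nonneg _) two_ne_zero).mp h2

/-- **slicewise comparison ⇒ norm comparison**: `‖f_r‖ ≤ c‖g_r‖` for all grades gives `‖f‖ ≤ c‖g‖`.
[cite: Balaban1984PropagatorsI, Prop. 1.1 (1.89) p.33] -/
theorem norm_le_of_sl {f g : Vsp n M} {c : ℝ} (hc : 0 ≤ c) (h : ∀ r, l2R (sl f r) ≤ c * l2R (sl g r)) : ‖f‖ ≤ c * ‖g‖ := by
  have h2 : ‖f‖ ^ 2 ≤ (c * ‖g‖) ^ 2 := by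
    rw [normSq_eq_sum_l2R_sq, mul_pow, normSq_eq_sum_l2R_sq, Finset.mul_sum]
    exact Finset.sum_le_sum fun r _ => by rw [← mul_pow]; exact pow_le_pow_left₀ (l2R_nonneg _) (h r) 2
  exact (pow_le_pow_iff_left₀ (norm_nonneg _) (by positivity) two_ne_zero).mp h2

/-- **slicewise gradient comparison ⇒ `‖Dg f‖ ≤ c‖g‖`**. [cite: Balaban1984PropagatorsI, Prop. 1.1 (1.89) p.33 (‖∇GJ‖)] -/
theorem norm_Dg_le_of_sl {f g : Vsp n M} {c : ℝ} (hc : 0 ≤ c) (h : ∀ r, l2TR (gradR n M (sl f r)) ≤ c * l2R (sl g r)) :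
    ‖Dg n M f‖ ≤ c * ‖g‖ := by
  have h2 : ‖Dg n M f‖ ^ 2 ≤ (c * ‖g‖) ^ 2 := by
    rw [normSq_Dg, mul_pow, normSq_eq_sum_l2R_sq, Finset.mul_sum]
    exact Finset.sum_le_sum fun r _ => by rw [← mul_pow]; exact pow_le_pow_left₀ (l2TR_nonneg _) (h r) 2
  exact (pow_le_pow_iff_left₀ (norm_nonneg _) (by positivity) two_ne_zero).mp h2

end Grades

/-! ## §2 `∇*` and `∇` between the grades -/

section Kernels

variable (n : ℕ) (M : Fin d → ℕ)

/-- **the inter-grade divergence kernel** `dK r r′ b b′` = the matrix element of `∇*` from (grade `r′`, bond `b′`) to (grade `r`, bond `b`):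
`(∇*g)₀ = Σ_ν ∇_νᵀ g_ν`, `(∇*g)_μ = Σ_{ν′} ∇_{ν′}ᵀ g_{μν′}`, zero otherwise (pv15's `fdiffR ν = re ∇_ν`, lattice factor `η⁻¹`).
[cite: Balaban1984PropagatorsI, Prop. 1.1 (1.89) p.33 (∇*J, ∇*∇*J), (1.21) p.21 (∂* the adjoint of ∂)] -/
def dK : Gr d → Gr d → Bnd n M → Bnd n M → ℝ
  | Sum.inl _, Sum.inr (Sum.inl ν), b, b' => fdiffR n M ν b' b
  | Sum.inr (Sum.inl μ), Sum.inr (Sum.inr p), b, b' => if p.1 = μ then fdiffR n M p.2 b' b else 0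
  | _, _, _, _ => 0

/-- the kernel of `∇*` on the graded index set. [cite: Balaban1984PropagatorsI, Prop. 1.1 (1.89) p.33] -/
def divK (p q : Idx n M) : ℝ := dK n M p.2 q.2 p.1 q.1

/-- the kernel of `∇` = the transpose of the kernel of `∇*`. [cite: Balaban1984PropagatorsI, (1.21) p.21 (∂* is the adjoint of ∂)] -/
def gradK (p q : Idx n M) : ℝ := divK n M q p

variable {n M}

/-- table of `dK`. [cite: Balaban1984PropagatorsI, Prop. 1.1 (1.89) p.33] -/
theorem dK_g0_g1 (ν : Fin d) (b b' : Bnd n M) : dK n M g0 (g1 ν) b b' = fdiffR n M ν b' b := rfl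
/-- table of `dK`. [cite: Balaban1984PropagatorsI, Prop. 1.1 (1.89) p.33] -/
theorem dK_g1_g2 (μ : Fin d) (p : Fin d × Fin d) (b b' : Bnd n M) :
    dK n M (g1 μ) (g2 p) b b' = if p.1 = μ then fdiffR n M p.2 b' b else 0 := rfl
/-- table of `dK`. [cite: Balaban1984PropagatorsI, Prop. 1.1 (1.89) p.33] -/
theorem dK_g0_g0 (b b' : Bnd n M) : dK n M g0 g0 b b' = 0 := rfl
/-- table of `dK`. [cite: Balaban1984PropagatorsI, Prop. 1.1 (1.89) p.33] -/
theorem dK_g0_g2 (p : Fin d × Fin d) (b b' : Bnd n M) : dK n M g0 (g2 p) b b' = 0 := rfl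
/-- table of `dK`. [cite: Balaban1984PropagatorsI, Prop. 1.1 (1.89) p.33] -/
theorem dK_g1_g0 (μ : Fin d) (b b' : Bnd n M) : dK n M (g1 μ) g0 b b' = 0 := rfl
/-- table of `dK`. [cite: Balaban1984PropagatorsI, Prop. 1.1 (1.89) p.33] -/
theorem dK_g1_g1 (μ ν : Fin d) (b b' : Bnd n M) : dK n M (g1 μ) (g1 ν) b b' = 0 := rfl
/-- table of `dK`. [cite: Balaban1984PropagatorsI, Prop. 1.1 (1.89) p.33] -/
theorem dK_g2 (p : Fin d × Fin d) (r : Gr d) (b b' : Bnd n M) : dK n M (g2 p) r b b' = 0 := by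
  rcases r with _ | _ | _ <;> rfl

variable (n M) [NeZero n] [hM : ∀ μ, NeZero (M μ)]

/-- **`∇*` on the graded carrier.** [cite: Balaban1984PropagatorsI, Prop. 1.1 (1.89) p.33 (G∇*J, G∇*∇*J)] -/
def divOp : Module.End ℝ (Vsp n M) := kerOp (divK n M)

/-- **`∇` on the graded carrier.** [cite: Balaban1984PropagatorsI, Prop. 1.1 (1.89) p.33 (∇GJ, ∇∇GJ)] -/
def gradOp : Module.End ℝ (Vsp n M) := kerOp (gradK n M)

variable {n M}

/-- a kernel operator on the graded index set, summed grade by grade. [cite: Balaban1984PropagatorsI, Prop. 1.1 p.33] -/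
theorem kerOp_apply_Gr (K : Idx n M → Idx n M → ℝ) (f : Vsp n M) (p : Idx n M) :
    kerOp K f p = ∑ b, K p (b, g0) * f (b, g0) + ∑ ν, ∑ b, K p (b, g1 ν) * f (b, g1 ν)
      + ∑ q, ∑ b, K p (b, g2 q) * f (b, g2 q) := by
  rw [kerOp_apply, Fintype.sum_prod_type_right, sum_Gr]

/-- `(∇f)₀ = 0`. [cite: Balaban1984PropagatorsI, Prop. 1.1 (1.89) p.33] -/
theorem sl_gradOp_g0 (f : Vsp n M) : sl (gradOp n M f) g0 = 0 := by
  funext b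
  rw [sl_apply, gradOp, kerOp_apply_Gr]
  simp [gradK, divK, dK_g0_g0, dK_g1_g0, dK_g2]

/-- **`(∇f)_ν = ∇_ν f₀`** (pv15's `gradR`). [cite: Balaban1984PropagatorsI, Prop. 1.1 (1.89) p.33 (∇GJ)] -/
theorem sl_gradOp_g1 (f : Vsp n M) (ν : Fin d) : sl (gradOp n M f) (g1 ν) = fdiffR n M ν *ᵥ sl f g0 := by
  funext b
  rw [sl_apply, gradOp, kerOp_apply_Gr]
  simp only [gradK, divK, dK_g0_g1, dK_g1_g1, dK_g2, zero_mul, Finset.sum_const_zero, add_zero]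
  rfl

/-- **`(∇f)_{μν′} = ∇_{ν′} f_μ`**. [cite: Balaban1984PropagatorsI, Prop. 1.1 (1.89) p.33 (∇∇GJ)] -/
theorem sl_gradOp_g2 (f : Vsp n M) (p : Fin d × Fin d) : sl (gradOp n M f) (g2 p) = fdiffR n M p.2 *ᵥ sl f (g1 p.1) := by
  funext b
  rw [sl_apply, gradOp, kerOp_apply_Gr]
  simp only [gradK, divK, dK_g0_g2, dK_g1_g2, dK_g2, zero_mul, Finset.sum_const_zero, zero_add, add_zero]
  rw [Finset.sum_eq_single p.1 (fun ν _ hν => by simp [Ne.symm hν]) (fun h => absurd (Finset.mem_univ _) h)]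
  simp only [if_true]
  rfl

/-- **`(∇*g)₀ = Σ_ν ∇_νᵀ g_ν`** (pv15's `divTR`). [cite: Balaban1984PropagatorsI, Prop. 1.1 (1.89) p.33 (G∇*J)] -/
theorem sl_divOp_g0 (g : Vsp n M) : sl (divOp n M g) g0 = divTR n M fun ν => sl g (g1 ν) := by
  funext b
  rw [sl_apply, divOp, kerOp_apply_Gr]
  simp only [divK, dK_g0_g0, dK_g0_g1, dK_g0_g2, zero_mul, Finset.sum_const_zero, zero_add, add_zero]
  rw [divTR, Finset.sum_apply]
  rfl

/-- **`(∇*g)_μ = Σ_{ν′} ∇_{ν′}ᵀ g_{μν′}`**. [cite: Balaban1984PropagatorsI, Prop. 1.1 (1.89) p.33 (G∇*∇*J)] -/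
theorem sl_divOp_g1 (g : Vsp n M) (μ : Fin d) :
    sl (divOp n M g) (g1 μ) = ∑ ν', (fdiffR n M ν')ᵀ *ᵥ sl g (g2 (μ, ν')) := by
  funext b
  rw [sl_apply, divOp, kerOp_apply_Gr]
  simp only [divK, dK_g1_g0, dK_g1_g1, dK_g1_g2, zero_mul, Finset.sum_const_zero, zero_add]
  rw [Fintype.sum_prod_type, Finset.sum_eq_single μ (fun μ' _ hμ => by simp [hμ]) (fun h => absurd (Finset.mem_univ _) h),
    Finset.sum_apply]
  simp only [if_true]
  rfl

/-- `(∇*g)_{μν′} = 0`. [cite: Balaban1984PropagatorsI, Prop. 1.1 (1.89) p.33] -/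
theorem sl_divOp_g2 (g : Vsp n M) (p : Fin d × Fin d) : sl (divOp n M g) (g2 p) = 0 := by
  funext b
  rw [sl_apply, divOp, kerOp_apply_Gr]
  simp [divK, dK_g2]

/-- **`⟨∇u, v⟩ = ⟨u, ∇*v⟩`** (one kernel and its transpose). [cite: Balaban1984PropagatorsI, (1.21) p.21 (∂* the adjoint of ∂), p.39 (the adjoint representation)] -/
theorem inner_gradOp_left (u v : Vsp n M) : inner ℝ (gradOp n M u) v = inner ℝ u (divOp n M v) :=
  inner_kerOp_left _ u v

/-- `⟨∇∇u, v⟩ = ⟨u, ∇*∇*v⟩`. [cite: Balaban1984PropagatorsI, p.39 (the adjoint representation for G∇*∇*J)] -/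
theorem inner_gradOp_gradOp_left (u v : Vsp n M) :
    inner ℝ (gradOp n M (gradOp n M u)) v = inner ℝ u (divOp n M (divOp n M v)) := by
  rw [inner_gradOp_left, inner_gradOp_left]

/-- **`‖∇f‖² = ‖∇f₀‖² + Σ_μ ‖∇f_μ‖²`** (pv15's tensor norms of `gradR`). [cite: Balaban1984PropagatorsI, Prop. 1.1 (1.89) p.33] -/
theorem normSq_gradOp (f : Vsp n M) :
    ‖gradOp n M f‖ ^ 2 = l2TR (gradR n M (sl f g0)) ^ 2 + ∑ μ, l2TR (gradR n M (sl f (g1 μ))) ^ 2 := by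
  rw [normSq_Gr, sl_gradOp_g0, l2R_zero, zero_pow two_ne_zero, zero_add, l2TR_sq_sum]
  congr 1
  · exact Finset.sum_congr rfl fun ν _ => by rw [sl_gradOp_g1]; rfl
  · rw [Fintype.sum_prod_type]
    refine Finset.sum_congr rfl fun μ _ => ?_
    rw [l2TR_sq_sum]
    exact Finset.sum_congr rfl fun ν' _ => by rw [sl_gradOp_g2]; rfl

/-- **`‖∇∇f‖² = ‖∇∇f₀‖²`** (pv15's `grad2R`; the two indices swapped, same sum). [cite: Balaban1984PropagatorsI, Prop. 1.1 (1.89) p.33 (∇∇GJ)] -/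
theorem normSq_gradOp_gradOp (f : Vsp n M) : ‖gradOp n M (gradOp n M f)‖ ^ 2 = l2TR (grad2R n M (sl f g0)) ^ 2 := by
  rw [normSq_Gr, sl_gradOp_g0, l2R_zero, zero_pow two_ne_zero, zero_add]
  have h1 : ∑ ν, l2R (sl (gradOp n M (gradOp n M f)) (g1 ν)) ^ 2 = 0 := by
    refine Finset.sum_eq_zero fun ν _ => ?_
    rw [sl_gradOp_g1, sl_gradOp_g0, Matrix.mulVec_zero, l2R_zero, zero_pow two_ne_zero]
  rw [h1, zero_add, l2TR_sq_sum]
  exact Fintype.sum_equiv (Equiv.prodComm (Fin d) (Fin d)) _ _ fun p => by rw [sl_gradOp_g2, sl_gradOp_g1]; rfl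

/-- **`‖∇f‖ ≤ c‖g‖` from slicewise gradient bounds on grades 0 and 1.** [cite: Balaban1984PropagatorsI, Prop. 1.1 (1.89) p.33, (1.125) p.38] -/
theorem norm_gradOp_le_of_sl {f g : Vsp n M} {c : ℝ} (hc : 0 ≤ c)
    (h0 : l2TR (gradR n M (sl f g0)) ≤ c * l2R (sl g g0))
    (h1 : ∀ μ, l2TR (gradR n M (sl f (g1 μ))) ≤ c * l2R (sl g (g1 μ))) : ‖gradOp n M f‖ ≤ c * ‖g‖ := by
  have h2 : ‖gradOp n M f‖ ^ 2 ≤ (c * ‖g‖) ^ 2 := by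
    rw [normSq_gradOp, mul_pow, normSq_Gr g]
    have t0 := pow_le_pow_left₀ (l2TR_nonneg _) h0 2
    have t1 : ∑ μ, l2TR (gradR n M (sl f (g1 μ))) ^ 2 ≤ ∑ μ, (c * l2R (sl g (g1 μ))) ^ 2 :=
      Finset.sum_le_sum fun μ _ => pow_le_pow_left₀ (l2TR_nonneg _) (h1 μ) 2
    have t2 : 0 ≤ c ^ 2 * ∑ p, l2R (sl g (g2 p)) ^ 2 := by positivity
    have e1 : ∑ μ, (c * l2R (sl g (g1 μ))) ^ 2 = c ^ 2 * ∑ μ, l2R (sl g (g1 μ)) ^ 2 := by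
      rw [Finset.mul_sum]; exact Finset.sum_congr rfl fun μ _ => by ring
    rw [mul_pow] at t0
    rw [e1] at t1
    nlinarith
  exact (pow_le_pow_iff_left₀ (norm_nonneg _) (by positivity) two_ne_zero).mp h2

/-- **`‖∇∇f‖ ≤ c‖g‖` from a slicewise second-gradient bound on grade 0.** [cite: Balaban1984PropagatorsI, Prop. 1.1 (1.89) p.33 (∇∇GJ), (1.125) p.38] -/
theorem norm_gradOp_gradOp_le_of_sl {f g : Vsp n M} {c : ℝ} (hc : 0 ≤ c)
    (h0 : l2TR (grad2R n M (sl f g0)) ≤ c * l2R (sl g g0)) : ‖gradOp n M (gradOp n M f)‖ ≤ c * ‖g‖ := by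
  have h2 : ‖gradOp n M (gradOp n M f)‖ ^ 2 ≤ (c * ‖g‖) ^ 2 := by
    rw [normSq_gradOp_gradOp, mul_pow, normSq_Gr g]
    have t0 := pow_le_pow_left₀ (l2TR_nonneg _) h0 2
    have t2 : 0 ≤ c ^ 2 * (∑ ν, l2R (sl g (g1 ν)) ^ 2 + ∑ p, l2R (sl g (g2 p)) ^ 2) := by positivity
    rw [mul_pow] at t0
    nlinarith
  exact (pow_le_pow_iff_left₀ (norm_nonneg _) (by positivity) two_ne_zero).mp h2

end Kernels

/-! ## §3 The cut-offs `ζ` and the multipliers, slicewise -/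

section Cuts

variable (n : ℕ) (M : Fin d → ℕ) [NeZero n] [hM : ∀ μ, NeZero (M μ)]

/-- **multiplication by the cut-off `ζ(x)`** on every grade and component (the `cut` of `B5Local114.Realisation`).
[cite: Balaban1984PropagatorsI, Prop. 1.2 (1.111), (1.114) pp.35–36 (ζ ∈ C₀^∞(Δ̃(y)))] -/
def cut (ζ : Tor (fine n M) → ℝ) : Module.End ℝ (Vsp n M) := mulOp fun p => ζ p.1.1

variable {n M}

omit [NeZero n] hM in
/-- slices of a multiplication operator. [cite: Balaban1984PropagatorsI, (1.118) p.36] -/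
theorem sl_mulOp (c : Idx n M → ℝ) (f : Vsp n M) (r : Gr d) : sl (mulOp c f) r = fun b => c (b, r) * sl f r b := rfl

omit [NeZero n] hM in
/-- slices of `ζ f`. [cite: Balaban1984PropagatorsI, Prop. 1.2 (1.114) p.36] -/
theorem sl_cut (ζ : Tor (fine n M) → ℝ) (f : Vsp n M) (r : Gr d) : sl (cut n M ζ f) r = fun b => ζ b.1 * sl f r b := rfl

omit [NeZero n] hM in
/-- slices of `h_z f`. [cite: Balaban1984PropagatorsI, (1.118) p.36] -/
theorem sl_Hop (M₀ : ℕ) (z : Cen M M₀) (f : Vsp n M) (r : Gr d) :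
    sl (Hop n M M₀ z f) r = fun b => hz M M₀ z (ucPt M n b.1) * sl f r b := rfl

/-- the cut-offs are symmetric — the field `symmCut`. [cite: Balaban1984PropagatorsI, Prop. 1.2 (1.114) p.36] -/
theorem cut_symm (ζ : Tor (fine n M) → ℝ) (u v : Vsp n M) : inner ℝ (cut n M ζ u) v = inner ℝ u (cut n M ζ v) :=
  inner_mulOp_left _ u v

/-- **`‖ζ v‖ ≤ |ζ|·‖v‖`** — the field `hcut` (`|ζ|` = r02's `cutSupL`). [cite: Balaban1984PropagatorsI, Prop. 1.2 (1.114) p.36 (the factor |ζ|)] -/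
theorem norm_cut_le (ζ : Tor (fine n M) → ℝ) (v : Vsp n M) : ‖cut n M ζ v‖ ≤ cutSupL n M ζ * ‖v‖ :=
  norm_mulOp_le (cutSupL_nonneg ζ) (fun p => by rw [← Real.norm_eq_abs]; exact LatticeNorms.norm_le_supNorm ζ (Finset.mem_univ p.1.1)) v

end Cuts

/-! ## §4 The sources `J` placed in their grade, with the weight `η^{d/2}` -/

section Sources

variable (n : ℕ) (M : Fin d → ℕ)

/-- the inverse of slicing: a graded family of real fields as a vector of the carrier. [cite: Balaban1984PropagatorsI, Prop. 1.1 p.33] -/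
def place (F : Gr d → Bnd n M → ℝ) : Vsp n M := WithLp.toLp 2 fun p => F p.2 p.1

/-- a vector field in grade 0. [cite: Balaban1984PropagatorsI, Prop. 1.1 (1.89) p.33 (J of GJ)] -/
def src0 (J : Bnd n M → ℝ) : Gr d → Bnd n M → ℝ
  | Sum.inl _ => J
  | Sum.inr _ => 0

/-- a 2-tensor field in grade 1. [cite: Balaban1984PropagatorsI, Prop. 1.1 (1.89) p.33 (J of G∇*J)] -/
def src1 (J : Fin d → Bnd n M → ℝ) : Gr d → Bnd n M → ℝ
  | Sum.inr (Sum.inl ν) => J ν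
  | _ => 0

/-- a 3-tensor field in grade 2. [cite: Balaban1984PropagatorsI, Prop. 1.1 (1.89) p.33 (J of G∇*∇*J)] -/
def src2 (J : Fin d × Fin d → Bnd n M → ℝ) : Gr d → Bnd n M → ℝ
  | Sum.inr (Sum.inr p) => J p
  | _ => 0

/-- the three kinds of real sources of the setting of record, each in its grade. [cite: Balaban1984PropagatorsI, Prop. 1.1 (1.89) p.33] -/
def srcF : LocR n M → Gr d → Bnd n M → ℝ
  | .vec J => src0 n M J
  | .ten J => src1 n M J
  | .ten2 J => src2 n M J

/-- **THE SOURCE MAP `vec J = η^{d/2}·J`** (the `vec` of `B5Local114.Realisation`; the factor is the weight of `L²(T_η)`, (1.21)).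
[cite: Balaban1984PropagatorsI, (1.21) p.21, Prop. 1.1 (1.89) p.33] -/
def vsrc (J : LocR n M) : Vsp n M := sqEta n d • place n M (srcF n M J)

variable {n M}

/-- slicing undoes placing. [cite: Balaban1984PropagatorsI, Prop. 1.1 p.33] -/
theorem sl_place (F : Gr d → Bnd n M → ℝ) (r : Gr d) : sl (place n M F) r = F r := rfl

variable [NeZero n] [hM : ∀ μ, NeZero (M μ)]

/-- `‖place F‖²` grade by grade. [cite: Balaban1984PropagatorsI, Prop. 1.1 p.33] -/
theorem normSq_place (F : Gr d → Bnd n M → ℝ) :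
    ‖place n M F‖ ^ 2 = l2R (F g0) ^ 2 + ∑ ν, l2R (F (g1 ν)) ^ 2 + ∑ p, l2R (F (g2 p)) ^ 2 := by
  rw [normSq_Gr]; rfl

/-- **`‖J placed‖ = ‖J‖`** (r02's `locNorm` of the embedded source). [cite: Balaban1984PropagatorsI, Prop. 1.1 (1.89) p.33 (‖J‖)] -/
theorem norm_place_srcF (J : LocR n M) : ‖place n M (srcF n M J)‖ = locNorm J.emb := by
  have h2 : ‖place n M (srcF n M J)‖ ^ 2 = locNorm J.emb ^ 2 := by
    rw [normSq_place]
    cases J with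
    | vec J =>
      show l2R J ^ 2 + ∑ ν : Fin d, l2R (0 : Bnd n M → ℝ) ^ 2 + ∑ p : Fin d × Fin d, l2R (0 : Bnd n M → ℝ) ^ 2 = l2 (cplx J) ^ 2
      rw [l2R_zero, zero_pow two_ne_zero, Finset.sum_const_zero, Finset.sum_const_zero, add_zero, add_zero, l2R_eq]
    | ten J =>
      show l2R (0 : Bnd n M → ℝ) ^ 2 + ∑ ν, l2R (J ν) ^ 2 + ∑ p : Fin d × Fin d, l2R (0 : Bnd n M → ℝ) ^ 2
        = l2T (fun ν => cplx (J ν)) ^ 2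
      rw [l2R_zero, zero_pow two_ne_zero, Finset.sum_const_zero, zero_add, add_zero, ← l2TR_sq_sum, l2TR_eq]
    | ten2 J =>
      show l2R (0 : Bnd n M → ℝ) ^ 2 + ∑ ν : Fin d, l2R (0 : Bnd n M → ℝ) ^ 2 + ∑ p, l2R (J p) ^ 2
        = l2T (fun p => cplx (J p)) ^ 2
      rw [l2R_zero, zero_pow two_ne_zero, Finset.sum_const_zero, zero_add, zero_add, ← l2TR_sq_sum, l2TR_eq]
  exact (pow_left_inj₀ (norm_nonneg _) (locNorm_nonneg _) two_ne_zero).mp h2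

variable (a : ℝ) (k : ℕ)

/-- **`‖vec J‖ = ‖J‖_{L²(T_η)}`** (the `l2Norm` of the setting of record). [cite: Balaban1984PropagatorsI, (1.21) p.21, Prop. 1.1 (1.89) p.33] -/
theorem norm_vsrc (J : LocR n M) : ‖vsrc n M J‖ = (latticeSettingP12R n M a k).l2Norm J := by
  show ‖vsrc n M J‖ = sqEta n d * locNorm J.emb
  rw [vsrc, norm_smul, Real.norm_of_nonneg (sqEta_nonneg n d), norm_place_srcF]

/-- the field `hvec` of `B5Local114.Realisation`. [cite: Balaban1984PropagatorsI, Prop. 1.1 (1.89) p.33] -/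
theorem hvec_holds (J : LocR n M) : ‖vsrc n M J‖ ≤ (latticeSettingP12R n M a k).l2Norm J := (norm_vsrc a k J).le

end Sources

/-! ## §5 The tables `D₁`, `D₂`, `D₂†` and the entries of (1.114) -/

section Entries

variable (n : ℕ) (M : Fin d → ℕ) [NeZero n] [hM : ∀ μ, NeZero (M μ)]

/-- **`D₁ = (1, ∇, 1, ∇, ∇∇, 1)`** for the six entries `‖ζGJ‖, ‖ζ∇GJ‖, ‖ζG∇*J‖, ‖ζ∇G∇*J‖, ‖ζ∇∇GJ‖, ‖ζG∇*∇*J‖` of (1.114).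
[cite: Balaban1984PropagatorsI, Prop. 1.2 (1.114) p.36] -/
def D1v : Fin 6 → Module.End ℝ (Vsp n M) := ![1, gradOp n M, 1, gradOp n M, gradOp n M * gradOp n M, 1]

/-- **`D₂ = (1, 1, ∇*, ∇*, 1, ∇*∇*)`**. [cite: Balaban1984PropagatorsI, Prop. 1.2 (1.114) p.36] -/
def D2v : Fin 6 → Module.End ℝ (Vsp n M) := ![1, 1, divOp n M, divOp n M, 1, divOp n M * divOp n M]

/-- **`D₂† = (1, 1, ∇, ∇, 1, ∇∇)`** (the adjoint representation, p. 39). [cite: Balaban1984PropagatorsI, p.39] -/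
def Dadjv : Fin 6 → Module.End ℝ (Vsp n M) := ![1, 1, gradOp n M, gradOp n M, 1, gradOp n M * gradOp n M]

variable {n M}

/-- **`⟨D₂†u, v⟩ = ⟨u, D₂v⟩`** for every entry. [cite: Balaban1984PropagatorsI, p.39 («a representation of G adjoint to (1.123)»)] -/
theorem Dadjv_adjoint (m : Fin 6) (u v : Vsp n M) : inner ℝ (Dadjv n M m u) v = inner ℝ u (D2v n M m v) := by
  fin_cases m
  · rfl
  · rfl
  · exact inner_gradOp_left u v
  · exact inner_gradOp_left u v
  · rfl
  · exact inner_gradOp_gradOp_left u v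

/-- `D₁ = 1` for the two left entries `m = 2, 5`. [cite: Balaban1984PropagatorsI, p.39] -/
theorem D1v_two : D1v n M 2 = 1 := rfl
/-- `D₁ = 1` for the two left entries `m = 2, 5`. [cite: Balaban1984PropagatorsI, p.39] -/
theorem D1v_five : D1v n M 5 = 1 := rfl

/-! ### the three shapes of the comparison `l2loc ≤ ‖cut ζ (…)‖` -/

/-- a vector-valued entry: `‖ζ·u‖_{ℓ²} ≤ ‖ζ w‖` when `u` is the grade-0 slice of `w`. [cite: Balaban1984PropagatorsI, Prop. 1.2 (1.114) p.36] -/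
theorem l2_smulV_cplx_le {w : Vsp n M} (ζ : Tor (fine n M) → ℝ) {u : Bnd n M → ℝ} (hu : sl w g0 = u) :
    l2 (smulV n M ζ (cplx u)) ≤ ‖cut n M ζ w‖ := by
  subst hu
  have e : smulV n M ζ (cplx (sl w g0)) = cplx (sl (cut n M ζ w) g0) := by
    funext b
    show (ζ b.1 : ℂ) * ((w (b, g0) : ℝ) : ℂ) = ((ζ b.1 * w (b, g0) : ℝ) : ℂ)
    rw [Complex.ofReal_mul]
  rw [e, ← l2R_eq]
  exact l2R_sl_le_norm _ _

/-- a 2-tensor-valued entry: `‖ζ·F‖ ≤ ‖ζ w‖` when `F_ν` are the grade-1 slices of `w`. [cite: Balaban1984PropagatorsI, Prop. 1.2 (1.114) p.36] -/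
theorem l2T_smulT_cplx_le {w : Vsp n M} (ζ : Tor (fine n M) → ℝ) {F : Fin d → Bnd n M → ℝ} (hF : ∀ ν, sl w (g1 ν) = F ν) :
    l2T (smulT n M ζ fun ν => cplx (F ν)) ≤ ‖cut n M ζ w‖ := by
  have e : (smulT n M ζ fun ν => cplx (F ν)) = fun ν => cplx (sl (cut n M ζ w) (g1 ν)) := by
    funext ν b
    show (ζ b.1 : ℂ) * ((F ν b : ℝ) : ℂ) = ((ζ b.1 * w (b, g1 ν) : ℝ) : ℂ)
    rw [← hF ν, Complex.ofReal_mul]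
    rfl
  rw [e, ← l2TR_eq]
  exact l2TR_sl_g1_le_norm _

/-- a 3-tensor-valued entry: `‖ζ·F‖ ≤ ‖ζ w‖` when `F_{νν′}` is the grade-2 slice `(ν′, ν)` of `w`. [cite: Balaban1984PropagatorsI, Prop. 1.2 (1.114) p.36] -/
theorem l2T_smulT_cplx_le₂ {w : Vsp n M} (ζ : Tor (fine n M) → ℝ) {F : Fin d × Fin d → Bnd n M → ℝ}
    (hF : ∀ p, sl w (g2 (p.2, p.1)) = F p) : l2T (smulT n M ζ fun p => cplx (F p)) ≤ ‖cut n M ζ w‖ := by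
  have e : (smulT n M ζ fun p => cplx (F p)) = fun p : Fin d × Fin d => cplx (sl (cut n M ζ w) (g2 (p.2, p.1))) := by
    funext p b
    show (ζ b.1 : ℂ) * ((F p b : ℝ) : ℂ) = ((ζ b.1 * w (b, g2 (p.2, p.1)) : ℝ) : ℂ)
    rw [← hF p, Complex.ofReal_mul]
    rfl
  rw [e, ← l2TR_eq]
  exact l2TR_sl_g2_swap_le_norm _

variable (a : ℝ) (k : ℕ)

/-- **entry `m = 0`, `‖ζGJ‖`.** [cite: Balaban1984PropagatorsI, Prop. 1.2 (1.114) p.36] -/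
theorem entry_zero_vec (ζ : Tor (fine n M) → ℝ) (J : Bnd n M → ℝ) :
    (latticeSettingP12R n M a k).l2loc 0 (LocR.vec J) ζ ≤ ‖cut n M ζ (Gop n M a (vsrc n M (LocR.vec J)))‖ := by
  show sqEta n d * l2 (smulV n M ζ ((DeltaA n M a)⁻¹ *ᵥ cplx J)) ≤ _
  simp only [vsrc, map_smul, norm_smul, Real.norm_of_nonneg (sqEta_nonneg n d)]
  refine mul_le_mul_of_nonneg_left ?_ (sqEta_nonneg n d)
  rw [← cplx_GR_mulVec]
  refine l2_smulV_cplx_le ζ ?_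
  rw [sl_Gop, sl_place]
  rfl

/-- **entry `m = 1`, `‖ζ∇GJ‖`.** [cite: Balaban1984PropagatorsI, Prop. 1.2 (1.114) p.36] -/
theorem entry_one_vec (ζ : Tor (fine n M) → ℝ) (J : Bnd n M → ℝ) :
    (latticeSettingP12R n M a k).l2loc 1 (LocR.vec J) ζ
      ≤ ‖cut n M ζ (gradOp n M (Gop n M a (vsrc n M (LocR.vec J))))‖ := by
  show sqEta n d * l2T (smulT n M ζ (grad n M ((DeltaA n M a)⁻¹ *ᵥ cplx J))) ≤ _
  simp only [vsrc, map_smul, norm_smul, Real.norm_of_nonneg (sqEta_nonneg n d)]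
  refine mul_le_mul_of_nonneg_left ?_ (sqEta_nonneg n d)
  have e : grad n M ((DeltaA n M a)⁻¹ *ᵥ cplx J) = fun ν => cplx (gradR n M (GR n M a *ᵥ J) ν) := by
    funext ν; rw [← cplx_GR_mulVec, cplx_gradR]
  rw [e]
  refine l2T_smulT_cplx_le ζ fun ν => ?_
  rw [sl_gradOp_g1, sl_Gop, sl_place]
  rfl

/-- **entry `m = 2`, `‖ζG∇*J‖`.** [cite: Balaban1984PropagatorsI, Prop. 1.2 (1.114) p.36] -/
theorem entry_two_ten (ζ : Tor (fine n M) → ℝ) (J : Fin d → Bnd n M → ℝ) :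
    (latticeSettingP12R n M a k).l2loc 2 (LocR.ten J) ζ
      ≤ ‖cut n M ζ (Gop n M a (divOp n M (vsrc n M (LocR.ten J))))‖ := by
  show sqEta n d * l2 (smulV n M ζ ((DeltaA n M a)⁻¹ *ᵥ divT n M fun ν => cplx (J ν))) ≤ _
  simp only [vsrc, map_smul, norm_smul, Real.norm_of_nonneg (sqEta_nonneg n d)]
  refine mul_le_mul_of_nonneg_left ?_ (sqEta_nonneg n d)
  rw [← cplx_divTR, ← cplx_GR_mulVec]
  refine l2_smulV_cplx_le ζ ?_
  rw [sl_Gop, sl_divOp_g0]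
  rfl

/-- **entry `m = 3`, `‖ζ∇G∇*J‖`.** [cite: Balaban1984PropagatorsI, Prop. 1.2 (1.114) p.36] -/
theorem entry_three_ten (ζ : Tor (fine n M) → ℝ) (J : Fin d → Bnd n M → ℝ) :
    (latticeSettingP12R n M a k).l2loc 3 (LocR.ten J) ζ
      ≤ ‖cut n M ζ (gradOp n M (Gop n M a (divOp n M (vsrc n M (LocR.ten J)))))‖ := by
  show sqEta n d * l2T (smulT n M ζ (grad n M ((DeltaA n M a)⁻¹ *ᵥ divT n M fun ν => cplx (J ν)))) ≤ _
  simp only [vsrc, map_smul, norm_smul, Real.norm_of_nonneg (sqEta_nonneg n d)]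
  refine mul_le_mul_of_nonneg_left ?_ (sqEta_nonneg n d)
  have e : grad n M ((DeltaA n M a)⁻¹ *ᵥ divT n M fun ν => cplx (J ν))
      = fun ν => cplx (gradR n M (GR n M a *ᵥ divTR n M J) ν) := by
    funext ν; rw [← cplx_divTR, ← cplx_GR_mulVec, cplx_gradR]
  rw [e]
  refine l2T_smulT_cplx_le ζ fun ν => ?_
  rw [sl_gradOp_g1, sl_Gop, sl_divOp_g0]
  rfl

/-- **entry `m = 4`, `‖ζ∇∇GJ‖`.** [cite: Balaban1984PropagatorsI, Prop. 1.2 (1.114) p.36] -/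
theorem entry_four_vec (ζ : Tor (fine n M) → ℝ) (J : Bnd n M → ℝ) :
    (latticeSettingP12R n M a k).l2loc 4 (LocR.vec J) ζ
      ≤ ‖cut n M ζ ((gradOp n M * gradOp n M) (Gop n M a (vsrc n M (LocR.vec J))))‖ := by
  show sqEta n d * l2T (smulT n M ζ (grad2 n M ((DeltaA n M a)⁻¹ *ᵥ cplx J))) ≤ _
  simp only [vsrc, map_smul, norm_smul, Real.norm_of_nonneg (sqEta_nonneg n d)]
  refine mul_le_mul_of_nonneg_left ?_ (sqEta_nonneg n d)
  have e : grad2 n M ((DeltaA n M a)⁻¹ *ᵥ cplx J) = fun p => cplx (grad2R n M (GR n M a *ᵥ J) p) := by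
    funext p; rw [← cplx_GR_mulVec, cplx_grad2R]
  rw [e]
  refine l2T_smulT_cplx_le₂ ζ fun p => ?_
  rw [Module.End.mul_apply, sl_gradOp_g2, sl_gradOp_g1, sl_Gop, sl_place]
  rfl

/-- **entry `m = 5`, `‖ζG∇*∇*J‖`.** [cite: Balaban1984PropagatorsI, Prop. 1.2 (1.114) p.36] -/
theorem entry_five_ten2 (ζ : Tor (fine n M) → ℝ) (J : Fin d × Fin d → Bnd n M → ℝ) :
    (latticeSettingP12R n M a k).l2loc 5 (LocR.ten2 J) ζ
      ≤ ‖cut n M ζ (Gop n M a ((divOp n M * divOp n M) (vsrc n M (LocR.ten2 J))))‖ := by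
  show sqEta n d * l2 (smulV n M ζ ((DeltaA n M a)⁻¹ *ᵥ divT2 n M fun p => cplx (J p))) ≤ _
  simp only [vsrc, map_smul, norm_smul, Real.norm_of_nonneg (sqEta_nonneg n d)]
  refine mul_le_mul_of_nonneg_left ?_ (sqEta_nonneg n d)
  rw [← cplx_divT2R, ← cplx_GR_mulVec]
  refine l2_smulV_cplx_le ζ ?_
  rw [sl_Gop, Module.End.mul_apply, sl_divOp_g0]
  congr 1
  rw [divTR, divT2R, Fintype.sum_prod_type]
  refine Finset.sum_congr rfl fun μ _ => ?_
  rw [sl_divOp_g1, Matrix.mulVec_sum]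
  rfl

/-- **THE FIELD `hentry` OF `B5Local114.Realisation` FOR THE TORUS OF RECORD**: every localized norm (1.114) of the setting of record
is below the carrier norm of the corresponding entry `cut ζ ∘ D₁ ∘ G ∘ D₂ ∘ vec` (the twelve off-table combinations have
localized norm `0`). [cite: Balaban1984PropagatorsI, Prop. 1.2 (1.114) p.36] -/
theorem hentry_holds (m : Fin 6) (J : LocR n M) (ζ : Tor (fine n M) → ℝ) :
    (latticeSettingP12R n M a k).l2loc m J ζ ≤ ‖cut n M ζ (D1v n M m (Gop n M a (D2v n M m (vsrc n M J))))‖ := by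
  have triv : ∀ w : Vsp n M, sqEta n d * 0 ≤ ‖w‖ := fun w => by rw [mul_zero]; exact norm_nonneg _
  rcases m with ⟨_ | _ | _ | _ | _ | _ | j, hj⟩
  · cases J with
    | vec J => exact entry_zero_vec a k ζ J
    | ten J => exact triv _
    | ten2 J => exact triv _
  · cases J with
    | vec J => exact entry_one_vec a k ζ J
    | ten J => exact triv _
    | ten2 J => exact triv _
  · cases J with
    | vec J => exact triv _
    | ten J => exact entry_two_ten a k ζ J
    | ten2 J => exact triv _
  · cases J with
    | vec J => exact triv _
    | ten J => exact entry_three_ten a k ζ J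
    | ten2 J => exact triv _
  · cases J with
    | vec J => exact entry_four_vec a k ζ J
    | ten J => exact triv _
    | ten2 J => exact triv _
  · cases J with
    | vec J => exact triv _
    | ten J => exact triv _
    | ten2 J => exact entry_five_ten2 a k ζ J
  · exact absurd hj (by omega)

end Entries

end

end Literature.MathematicalPhysics.QuantumFieldTheory.Balaban1983to89.B5WalkEntriesTorus
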